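import Summits.HodgeConjecture.CorCM.Census.HalfParityCount
import Summits.HodgeConjecture.CorCM.FaceHalfParityFloor
import Summits.HodgeConjecture.CorCM.FaceCoinvariantComplement
import HarnessLib

/-!
# The face HALF-PARITY LAW: `β(F) + t(F) = φ₂(F) + 1 + δ(F)` for every Galois CM field

COR-CM (cell `pub-hodgecm2`), count-neutral kernel combinatorics by the binder seat b09 (gen 31; lane DIRECT-FACTOR, sequel
«CLOSED-FORM LAW» = lit-andre-3ʼs ask A6-R55): the intrinsic form, for a Galois CM field `F`, of `Census/HalfParityLaw.lean` (X), `Census/HalfParityStabiliser.lean` (XI) and `Census/HalfParityCount.lean` (XIII);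
sequel of `CorCM/FaceHalfParityFloor.lean` (gen 30) and `CorCM/FaceCoinvariantComplement.lean` (gen 31).  Theorems only; no `decide`,
no certificate, no named fact, no `sorry`.  HONEST FRAMING: `HC_CM` is NOT proved; nothing here is a period.  T5: n/a-class (no
named-fact / conjecture-def binder; the one Prop binder is the generation binder `hgen(𝒮, σ₀)` of INT2-GEN, inhabited by
`FaceBasis.basisFace_hgen`).

THE STATEMENT (`card_block_add_halfRank_eq_fibreTwo_add`).  For every Galois CM field `F` (`G = GalT F`, `c = conjT`):
**`β(F) + t(F) = φ₂(F) + 1 + δ(F)`** — the coinvariant fibre `φ₂(F) = dim_𝔽₂ (Λ_F⊗𝔽₂)_{Gal}` (the census-free floor of every face-period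
route, `FaceCoinvariantFloor.fibreTwo_le_card_of_hgen`) is EXACTLY `β(F) − 1 − δ(F) + t(F)`: the number of isogeny classes of simple CM
abelian varieties split by `F`, minus one, minus the weight-parity relation, plus the rank `t(F)` of the admissible half-parities (one
family for each real quadratic subfield `k ⊂ F` all of whose blocks split over `k`).  Gen 30 proved `≤` (André-3ʼs law as a floor);
part X proves `≥`.  Consequences: `t(F) = 0 ⟺ φ₂(F) = β(F) − 1 − δ(F)` (cyclic, degree `2·odd`, split-cyclic, complemented
conjugation, no real quadratic subfield); **`φ₂(F) ≤ β(F) − 1 − δ(F) + (1 + δ(F))·h(F)`**, `h(F)` = number of index-two subgroups of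
`GalT F` containing `conjT` (= number of real quadratic subfields of `F`).

## References
* [Pohlmann1968] H. Pohlmann, Algebraic cycles on abelian varieties of complex multiplication type, Ann. of Math. 88 (1968), Thm 1.
* [Milne1999] J. S. Milne, Lefschetz motives and the Tate conjecture, Compositio Math. 117 (1999), Prop. 2.1, p. 54.
-/

noncomputable section

open NumberField NumberField.ComplexEmbedding

namespace Summit.HodgeConjecture.CorCM.FaceHalfParity

open Literature.AlgebraicGeometry.Motives (CMType)
open Summit.HodgeConjecture.CorCM.Prior.AllgGroup.RfwfAllgGroup
open Summit.HodgeConjecture.CorCM.Census.BlockParity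
open Summit.HodgeConjecture.CorCM.Census.Coinvariant
open Summit.HodgeConjecture.CorCM.Census.HalfParity

variable {F : Type} [Field F] [NumberField F]

/-- **THE FACE HALF-PARITY LAW: `β(F) + t(F) = φ₂(F) + 1 + δ(F)`** for every Galois CM field `F` (`δ(F)` read at any base type).
[folklore] -/
theorem card_block_add_halfRank_eq_fibreTwo_add [IsCMField F] [IsGalois ℚ F] (T₀ : CMF (GalT F) conjT) :
    Fintype.card (Block (conjT : GalT F)) + halfRank (conjT : GalT F) conjT_mul_self =
      fibreTwo (conjT : GalT F) conjT_mul_self + 1 + wdelta (conjT : GalT F) T₀ :=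
  Census.HalfParity.card_block_add_halfRank_eq_fibreTwo_add conjT conjT_mul_self conjT_ne_one
    (fun P => FaceBasis.conjT_comm P) T₀

/-- `δ`-free form: `β(F) + t(F) ∈ {φ₂(F) + 1, φ₂(F) + 2}`. [folklore] -/
theorem card_block_add_halfRank_eq_fibreTwo_add_two_or [IsCMField F] [IsGalois ℚ F] :
    Fintype.card (Block (conjT : GalT F)) + halfRank (conjT : GalT F) conjT_mul_self =
        fibreTwo (conjT : GalT F) conjT_mul_self + 2 ∨
      Fintype.card (Block (conjT : GalT F)) + halfRank (conjT : GalT F) conjT_mul_self =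
        fibreTwo (conjT : GalT F) conjT_mul_self + 1 :=
  Census.HalfParity.card_block_add_halfRank_eq_fibreTwo_add_two_or conjT conjT_mul_self conjT_ne_one
    (fun P => FaceBasis.conjT_comm P)

/-- **A Hodge vector of `F` mod `2` killed by every block parity and every admissible half-parity is a sum of pairs and
coboundaries of faces.** [folklore] -/
theorem mem_rad2_of_par2_eq_zero_of_hpi_eq_zero [IsCMField F] [IsGalois ℚ F] {x : CMF (GalT F) conjT →₀ ZMod 2}
    (hx : x ∈ hodge2 (conjT : GalT F) conjT_mul_self) (hpx : par2 (conjT : GalT F) x = 0)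
    (hhx : hpi (conjT : GalT F) conjT_mul_self x = 0) : x ∈ rad2 (conjT : GalT F) conjT_mul_self :=
  Census.HalfParity.mem_rad2_of_par2_eq_zero_of_hpi_eq_zero conjT conjT_mul_self conjT_ne_one
    (fun P => FaceBasis.conjT_comm P) hx hpx hhx

/-- **`φ₂(F)` is detected exactly by parities and half-parities**: `φ₂(F) = dim_𝔽₂ (par2, hpi)(hodge2)`. [folklore] -/
theorem fibreTwo_eq_finrank_map_prod [IsCMField F] [IsGalois ℚ F] :
    fibreTwo (conjT : GalT F) conjT_mul_self =
      Module.finrank (ZMod 2) ↥((hodge2 (conjT : GalT F) conjT_mul_self).map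
        ((par2 (conjT : GalT F)).prod (hpi (conjT : GalT F) conjT_mul_self))) :=
  Census.HalfParity.fibreTwo_eq_finrank_map_prod conjT conjT_mul_self conjT_ne_one (fun P => FaceBasis.conjT_comm P)

/-- **`t(F) = 0 ⟺ φ₂(F) + 1 + δ(F) = β(F)`** — the parity floor is the truth exactly when no new half-parity exists. [folklore] -/
theorem halfRank_eq_zero_iff [IsCMField F] [IsGalois ℚ F] (T₀ : CMF (GalT F) conjT) :
    halfRank (conjT : GalT F) conjT_mul_self = 0 ↔
      fibreTwo (conjT : GalT F) conjT_mul_self + 1 + wdelta (conjT : GalT F) T₀ = Fintype.card (Block (conjT : GalT F)) :=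
  Census.HalfParity.halfRank_eq_zero_iff conjT conjT_mul_self conjT_ne_one (fun P => FaceBasis.conjT_comm P) T₀

/-- **Complemented conjugation (`F ⊇` an imaginary quadratic field) ⇒ `t(F) = 0`.** [folklore] -/
theorem halfRank_eq_zero_of_cpl [IsCMField F] [IsGalois ℚ F] {A : Subgroup (GalT F)}
    (hA : ∀ P : GalT F, P ∈ A ↔ conjT * P ∉ A) : halfRank (conjT : GalT F) conjT_mul_self = 0 :=
  Census.HalfParity.halfRank_eq_zero_of_cpl conjT conjT_mul_self conjT_ne_one (fun P => FaceBasis.conjT_comm P) hA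

/-- **UPPER BOUND BY REAL QUADRATIC SUBFIELDS: `φ₂(F) + 1 + δ(F) ≤ β(F) + (1 + δ(F))·h(F)`**, `h(F)` = number of index-two subgroups of
`GalT F` containing `conjT`. [folklore] -/
theorem fibreTwo_add_le_card_block_add_mul_hTwo [IsCMField F] [IsGalois ℚ F] (T₀ : CMF (GalT F) conjT) :
    fibreTwo (conjT : GalT F) conjT_mul_self + 1 + wdelta (conjT : GalT F) T₀ ≤
      Fintype.card (Block (conjT : GalT F)) + (1 + wdelta (conjT : GalT F) T₀) * hTwo (conjT : GalT F) :=
  Census.HalfParity.fibreTwo_add_le_card_block_add_mul_hTwo conjT conjT_mul_self conjT_ne_one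
    (fun P => FaceBasis.conjT_comm P) T₀

/-- **No index-two subgroup contains `conjT` (`h(F) = 0`) ⇒ `φ₂(F) + 1 + δ(F) = β(F)`.** [folklore] -/
theorem fibreTwo_add_one_add_wdelta_eq_card_block_of_hTwo_eq_zero [IsCMField F] [IsGalois ℚ F] (T₀ : CMF (GalT F) conjT)
    (h : hTwo (conjT : GalT F) = 0) :
    fibreTwo (conjT : GalT F) conjT_mul_self + 1 + wdelta (conjT : GalT F) T₀ = Fintype.card (Block (conjT : GalT F)) :=
  Census.HalfParity.fibreTwo_add_one_add_wdelta_eq_card_block_of_hTwo_eq_zero conjT conjT_mul_self conjT_ne_one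
    (fun P => FaceBasis.conjT_comm P) T₀ h

/-- **THE `𝒦`-CRITERION for `F`**: if no index-two subgroup of `GalT F` containing `conjT` contains the stabiliser of every CM
type (XI; e.g. conjugation complemented, `Gal ≅ D₄` with `conj = r²`, `SL(2,3)`, …), then **`φ₂(F) + 1 + δ(F) = β(F)` and `t(F) = 0`**.
[folklore] -/
theorem fibreTwo_add_one_add_wdelta_eq_card_block_of_forall_exists_not_stab_le [IsCMField F] [IsGalois ℚ F]
    (hK : ∀ H : Subgroup (GalT F), H.index = 2 → conjT ∈ H → ∃ Ψ : CMF (GalT F) conjT, ¬ stab (conjT : GalT F) Ψ ≤ H)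
    (T₀ : CMF (GalT F) conjT) :
    fibreTwo (conjT : GalT F) conjT_mul_self + 1 + wdelta (conjT : GalT F) T₀ = Fintype.card (Block (conjT : GalT F)) ∧
      halfRank (conjT : GalT F) conjT_mul_self = 0 :=
  ⟨Census.HalfParity.fibreTwo_add_one_add_wdelta_eq_card_block_of_forall_exists_not_stab_le conjT conjT_mul_self conjT_ne_one
      (fun P => FaceBasis.conjT_comm P) hK T₀,
    Census.HalfParity.halfRank_eq_zero_of_forall_exists_not_stab_le conjT conjT_mul_self conjT_ne_one
      (fun P => FaceBasis.conjT_comm P) hK⟩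

/-- **ANDRÉ-3ʼS LAW IN CLOSED FORM for `F`: `φ₂(F) + 1 + [n even] = β(F) + dim_𝔽₂ 𝔛(F)`**, `n = [F:ℚ]/2`, `𝔛(F)` the
`𝔽₂`-space of additive `χ : GalT F → 𝔽₂` with `χ(conjT) = 0` killing the stabiliser of every CM type of `F` (XIII). [folklore] -/
theorem fibreTwo_add_eq_card_block_add_finrank_charK [IsCMField F] [IsGalois ℚ F] :
    fibreTwo (conjT : GalT F) conjT_mul_self + 1 + (if Even (Module.finrank ℚ F / 2) then 1 else 0) =
      Fintype.card (Block (conjT : GalT F)) + Module.finrank (ZMod 2) ↥(charK (conjT : GalT F)) := by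
  rw [← FaceCensus.card_galT (F := F)]
  exact Census.HalfParity.fibreTwo_add_eq_card_block_add_finrank_charK conjT conjT_mul_self conjT_ne_one
    (fun P => FaceBasis.conjT_comm P)

/-- **… and `t(F) + [n even] = dim 𝔛(F) + δ(F)`.** [folklore] -/
theorem halfRank_add_eq_finrank_charK [IsCMField F] [IsGalois ℚ F] (T₀ : CMF (GalT F) conjT) :
    halfRank (conjT : GalT F) conjT_mul_self + (if Even (Module.finrank ℚ F / 2) then 1 else 0) =
      Module.finrank (ZMod 2) ↥(charK (conjT : GalT F)) + wdelta (conjT : GalT F) T₀ := by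
  rw [← FaceCensus.card_galT (F := F)]
  exact Census.HalfParity.halfRank_add_eq_finrank_charK conjT conjT_mul_self conjT_ne_one (fun P => FaceBasis.conjT_comm P) T₀

/-- **The `hgen` SANDWICH, closed**: for every `hgen(𝒮, σ₀)` set of faces, `β(F) − 1 − δ(F) + t(F) = φ₂(F) ≤ |𝒮|`. [folklore] -/
theorem card_block_add_halfRank_le_card_add_of_hgen' [IsCMField F] [IsGalois ℚ F] (T₀ : CMF (GalT F) conjT)
    (𝒮 : Finset (Face F)) (σ₀ : F →+* ℂ)
    (hgen : ∀ f : Face F, lefChar f.corner (fun _ => ({σ₀} : Finset (F →+* ℂ))) ∈ AddSubgroup.closure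
      {a : Asym F | ∃ g ∈ (𝒮 : Set (Face F)), ∃ σ : F →+* ℂ, a = lefChar g.corner (fun _ => ({σ} : Finset (F →+* ℂ)))}) :
    Fintype.card (Block (conjT : GalT F)) + halfRank (conjT : GalT F) conjT_mul_self =
        fibreTwo (conjT : GalT F) conjT_mul_self + 1 + wdelta (conjT : GalT F) T₀ ∧
      fibreTwo (conjT : GalT F) conjT_mul_self ≤ 𝒮.card :=
  ⟨card_block_add_halfRank_eq_fibreTwo_add T₀, FaceCoinvariant.fibreTwo_le_card_of_hgen 𝒮 σ₀ hgen⟩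

end Summit.HodgeConjecture.CorCM.FaceHalfParity

end
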